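import Mathlib

/-!
# C4 · the BF-sandwich census of the 2-level WNSH-LF WINDOW (hsemireg-c4-1 g26 v1.0 §1–§5; g27 v1.1 adds §6, 2026-08-30)

Typed spec + kernel-checked letter-level lemmas behind memo `C4-SANDWICH-WINDOW-c4-1-g26.md`
(crux `BlochSeedDiscOne`, item stmt-HodgeConjecture-18881; EVIDENCE ONLY — nothing here is a rung toward
HC ∕ HC_CM ∕ HC_AV ∕ №4 ∕ 26512 ∕ 18881 ∕ H2; no `sorry`, no new axioms, Mathlib only, no `instance`
declarations (one `deriving DecidableEq` as in `C4BFSandwich.lean`), no notation, no banned option).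

Companion files of record (same directory): `C4BFSandwich.lean` (g19: LEMMA K, admissible ∕ hot pairs, design rule (R5)
SANDWICH-FREE, program-M census 216–240 hot pairs), `C4WindowPincer.lean` (g25: the apex∕ray pincer, letter poset `letterLE`),
`C4HNWindow.lean` (g23+g24, v1.1: NO-SPLIT-WINDOW).

Dictionary (g0 §1, g25 §5): a letter on one factor `S = E × E` (`E = ℂ/ℤ[i]`) is `[α, x, y]`, `n[α,x,y] = α² − x² − y²`
(`χ(L) = n`, Mumford index theorem: a non-degenerate `L` has exactly one non-zero cohomology group, in degree
`i(L) ∈ {0,1,2}`, of dimension `|n|`; `i = 0` iff ample, `i = 2` iff anti-ample, `i = 1` iff `n < 0`).  For an ORDERED pair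
(target `z`, source `s`) of letters the SLOT TYPE of `d = z − s` decides `H^•(S, L_z ⊗ L_s^∨ ⊗ P_ℓ)` for a label `ℓ ∈ Pic⁰(S)`:
`zero` (`d = 0`): `(1,2,1)` iff `ℓ = 0`, else `0`;  `amp` (`n>0, α>0`): `(n,0,0)` for every `ℓ`;  `anti` (`n>0, α<0`): `(0,0,n)`
for every `ℓ`;  `indef` (`n<0`): `(0,−n,0)` for every `ℓ`;  `isoP`∕`isoN` (`n = 0 ≠ d`, `±α > 0`): `(g,g,0)`∕`(0,g,g)` for `ℓ` on a
proper subtorus, else `0`.  LABEL-ROBUST cohomology (non-zero for EVERY `ℓ`) is therefore carried by `amp ∕ anti ∕ indef` slots only,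
in the single degree `0 ∕ 2 ∕ 1`; by Künneth on `X = S⁴`, `Ext^k(L_{Z′}λ′, L_Zλ) ≠ 0` for all labels iff every slot of `(Z, Z′)` is
robust and the slot degrees sum to `k`.

WHAT IS KERNEL-CHECKED HERE
§1 the slot-type table of the 36 ordered letter pairs of the window alphabet `{14I, 15I, R₁..R₄}` (`R = [13,±1,0],[13,0,±1]`):
   counts `zero 6 ∕ amp 5 ∕ anti 5 ∕ indef 12 ∕ isoP 4 ∕ isoN 4`, the `n`-values (`amp∕anti ∈ {1,3}`, `indef ∈ {−2,−4}`), and that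
   canonical incidence `letterLE` (g25) = `zero ∪ amp ∪ isoP` while LABEL-ROBUST incidence = `amp` only (THEOREM NS-COLD, letter half);
§2 the degree bookkeeping over all `6⁴ = 1296` slot-type vectors: robust `Ext²`-support ⟺ pattern R1 (`amp³·anti`) or R2
   (`amp²·indef²`); robust `Hom`-support ⟺ `amp⁴`; robust `Ext¹`-support ⟺ `amp³·indef`; hence "incidence and heat are disjoint"
   (no type vector is both); the counts `2500 = 4·5·5³`, `21600 = 6·12²·5²` (engine total 24100) and the `h²` ranges `[1,81]`, `≤ 144`;
§3 the two DOMINATION LEMMAS of the window alphabet: every cell `Z ≠ ⊤ = 15I⁴` lies below one of the four hub cells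
   `H_f = 14I_f·15I³`, and every cell with a hub letter (`14I` or `15I`) in some slot lies above a cell of A-type `14I_f·R³`;
§4 THEOREM SF-W (letter level): for any orientation of the window alphabet with `m_C(H_f) > 0` for the four hub cells (O1) and
   `m_A > 0` on every A-type cell (O2), a canonically C-target-free cell is `⊤` and a canonically A-source-free cell is an all-ray cell,
   so every admissible pair `(Z, Z′)` has four `amp` slots (`15I − R = [2,∓1,0]`, `n = 3`): COLD in every degree `≥ 1` for every
   labelling — the window designs of record are SANDWICH-FREE in the sense of `C4BFSandwich.Design.PairOracle.SandwichFree` (g19 (R5));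
   LEMMA C (the apex∕ray pincer pair is cold) is the same computation;
§5 the census digits of the six window designs of record (engine `code/g26/sandwich.py`), recorded not derived, with `decide`d
   consistency (`hot = 0`, `D_hot = 0` on all six; contrast `C4BFSandwich.Design.ofRecord_checks`: program M has `hot > 0`).
§6 (v1.1, g27, memo `C4-APEX-HALL-c4-1-g27.md`) the HUB CUBE `{14I<15I}⁴` of the window: the closure facts (above a hub cell
   there are only hub cells), the abstract **HUB-HALL LAW** `m_C(U) ≥ −ν(U)` for every Hall set `U` of hub vertices (generic
   injectivity of `i` makes every UP-SET a Hall set, for ANY labelling), its named instances (apex pair `m_C(⊤)+m_C(H_f) ≥ κ`, joint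
   `m_C(⊤)+Σ_f m_C(H_f) ≥ 7κ`, `κ = 1792`), the forced alternative **(O1∨⊤)** (`m_C(⊤) > 0` or (O1)) — so hypothesis (O1) of §4 is
   automatic and `ψ ⊆ {⊤}` is orientation-free — and **THEOREM SF-W♯**: with NO positivity hypothesis on the orientation beyond the
   apex-pair Hall inequalities, an admissible pair is `(⊤, Z′)` with `m_C(⊤) = 0` and slot types in `{zero, amp}`: never label-robustly
   hot (no `anti`∕`indef` slot), canonically hot iff `Z′` has a `15I` slot, which the census condition (O2‴) ("every N-cell with a `15I`
   slot lies above a cell with `m_A > 0`", weaker than (O2)) excludes; the canonical single-cell layer (monad-4 A-ISOLATION read on the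
   hub: `m_A(Z) ≤ m_N(Z)` ⇒ `m_C(Z) ≥ κ·2^a` at odd `a`) and the census digits of the five oriented designs (`Census2`, engine
   `code/g27/apexhall.py`: generic layer 0 violations of 52 binding up-sets on all five; joint apex slack `2 ∕ 1792 ∕ 12572 ∕ 0 (tight) ∕ 1792`;
   canonical layer violated on `1d7e39cf`∕`2f9bdad8` (86 sub-cube up-sets each), tight on the HNF pair, satisfied on `6ff297a3`; (O2‴) 0 exceptions).
NOT CHECKED HERE (pen, memo §B): the index-theorem dictionary above, Künneth, and LEMMA K itself (g19, kernel-checked there over an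
abstract `SandwichDatum`).  HONEST: sandwich-freeness removes an OBLIGATION on the maps of a posited display; it certifies nothing about
existence of a display, a sheaf or a SEED; the apex line-sub-bundle obligation of LEMMA K (memo §E, OBLIGATION A) is maps-level and is
NOT decided by any design datum.
-/

namespace HSemireg.C4SandwichWindow

/-! ## §1 Letters, slot types, the 36-pair table -/

/-- A letter `[α, x, y]` on one factor `S = E × E` (as in `C4WindowPincer`). -/
abbrev Letter := ℤ × ℤ × ℤ

/-- `n[α,x,y] = α² − x² − y²` (`= χ` of the line bundle). -/
def nrm (l : Letter) : ℤ := l.1 ^ 2 - l.2.1 ^ 2 - l.2.2 ^ 2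

/-- difference `target − source`. -/
def diff (z s : Letter) : Letter := (z.1 - s.1, z.2.1 - s.2.1, z.2.2 - s.2.2)

/-- canonical incidence `s ≤ z` (g25 `letterLE`, arguments in the order source, target): `z − s` is `0` or has `α > 0`, `n ≥ 0`. -/
def letterLE (s z : Letter) : Bool :=
  decide (s = z) || (decide (0 < (diff z s).1) && decide (0 ≤ nrm (diff z s)))

def L14 : Letter := (14, 0, 0)
def L15 : Letter := (15, 0, 0)
def rays : List Letter := [(13, 1, 0), (13, -1, 0), (13, 0, 1), (13, 0, -1)]
/-- the window alphabet on one factor -/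
def alphabet : List Letter := [L14, L15] ++ rays

/-- slot type of an ordered pair (target `z`, source `s`). -/
inductive SlotType
  | zero | amp | anti | indef | isoP | isoN
  deriving DecidableEq

open SlotType

/-- classification of `d = z − s` by `(d = 0, sign n, sign α)`. -/
def slotType (z s : Letter) : SlotType :=
  if z = s then zero
  else if 0 < nrm (diff z s) then (if 0 < (diff z s).1 then amp else anti)
  else if nrm (diff z s) < 0 then indef
  else (if 0 < (diff z s).1 then isoP else isoN)

/-- all 36 ordered pairs of the alphabet -/
def pairs : List (Letter × Letter) := alphabet.flatMap fun z => alphabet.map fun s => (z, s)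

/-- §1(a) the type counts `zero 6 ∕ amp 5 ∕ anti 5 ∕ indef 12 ∕ isoP 4 ∕ isoN 4` (total 36). -/
theorem type_counts :
    pairs.length = 36 ∧
    (pairs.countP fun p => slotType p.1 p.2 = zero) = 6 ∧
    (pairs.countP fun p => slotType p.1 p.2 = amp) = 5 ∧
    (pairs.countP fun p => slotType p.1 p.2 = anti) = 5 ∧
    (pairs.countP fun p => slotType p.1 p.2 = indef) = 12 ∧
    (pairs.countP fun p => slotType p.1 p.2 = isoP) = 4 ∧
    (pairs.countP fun p => slotType p.1 p.2 = isoN) = 4 := by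
  decide

/-- §1(b) the five `amp` pairs are exactly `15I − 14I` (`n = 1`) and `15I − R` (`n = 3`); `14I − R` is isotropic (`n = 0`, `isoP`);
distinct rays give `indef` with `n ∈ {−2, −4}`. -/
theorem amp_pairs :
    slotType L15 L14 = amp ∧ nrm (diff L15 L14) = 1 ∧
    (rays.all fun r => decide (slotType L15 r = amp) && decide (nrm (diff L15 r) = 3)) = true ∧
    (rays.all fun r => decide (slotType L14 r = isoP) && decide (nrm (diff L14 r) = 0)) = true ∧
    (rays.all fun r => rays.all fun r' =>
      decide (r = r') || (decide (slotType r r' = indef) &&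
        (decide (nrm (diff r r') = -2) || decide (nrm (diff r r') = -4)))) = true ∧
    (pairs.all fun p => !decide (slotType p.1 p.2 = amp) ||
      (decide (p.1 = L15) && (decide (p.2 = L14) || decide (p.2 ∈ rays)))) = true := by
  decide

/-- §1(c) THEOREM NS-COLD, letter half: canonical incidence `letterLE s z` holds exactly on the types `zero ∪ amp ∪ isoP`
(15 of 36 ordered pairs); the label-robust incidences are the `amp` ones (for `zero`∕`isoP` the `H⁰` dies off a proper closed
subset of labels — pen), and an `amp` difference has NO higher cohomology for any label (index theorem — pen). -/
theorem incidence_types :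
    (pairs.all fun p => letterLE p.2 p.1 ==
      (decide (slotType p.1 p.2 = zero) || decide (slotType p.1 p.2 = amp) || decide (slotType p.1 p.2 = isoP))) = true ∧
    (pairs.countP fun p => letterLE p.2 p.1) = 15 := by
  decide

/-! ## §2 Degree bookkeeping over slot-type vectors (Künneth with singleton supports) -/

/-- the robust degree of a slot: `amp ↦ 0`, `indef ↦ 1`, `anti ↦ 2`, fragile types `↦ none`. -/
def rdeg : SlotType → Option ℕ
  | amp => some 0
  | indef => some 1
  | anti => some 2
  | _ => none

/-- total robust degree of a type vector (`none` as soon as one slot is fragile): the unique `k` with label-robust `Ext^k ≠ 0`. -/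
def rdegSum : List SlotType → Option ℕ
  | [] => some 0
  | t :: ts => match rdeg t, rdegSum ts with
    | some a, some b => some (a + b)
    | _, _ => none

/-- pattern R1: one `anti` slot, three `amp` slots. -/
def isR1 (t : List SlotType) : Bool := decide (t.count anti = 1) && decide (t.count amp = 3)
/-- pattern R2: two `indef` slots, two `amp` slots. -/
def isR2 (t : List SlotType) : Bool := decide (t.count indef = 2) && decide (t.count amp = 2)

/-- §2(a) CLASSIFICATION of label-robust HOT ordered cell pairs on `X = S⁴` (all `6⁴ = 1296` slot-type vectors, by cases):
robust `Ext²`-support ⟺ R1 ∨ R2; robust `Hom`-support ⟺ `amp⁴`; robust `Ext¹`-support ⟺ `amp³·indef`.  In particular no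
vector carries two robust degrees ("incidence and heat are disjoint", THEOREM NS-COLD, Künneth half). -/
theorem robust_degree_classification (a b c d : SlotType) :
    ((rdegSum [a, b, c, d] = some 2) ↔ (isR1 [a, b, c, d] || isR2 [a, b, c, d]) = true) ∧
    ((rdegSum [a, b, c, d] = some 0) ↔ [a, b, c, d].count amp = 4) ∧
    ((rdegSum [a, b, c, d] = some 1) ↔ ([a, b, c, d].count amp = 3 ∧ [a, b, c, d].count indef = 1)) := by
  cases a <;> cases b <;> cases c <;> cases d <;> decide

/-- the R1 ∕ R2 slot patterns: `C(4,1) = 4` positions of the `anti` slot, `C(4,2) = 6` positions of the two `indef` slots. -/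
theorem pattern_counts : Nat.choose 4 1 = 4 ∧ Nat.choose 4 2 = 6 := by decide

/-- §2(b) the counts of label-robust hot ordered CELL pairs over the full window alphabet `6⁴ × 6⁴`
(engine `sandwich.py`: 24100 = 2500 (R1) + 21600 (R2)), from the per-slot pair counts of §1(a). -/
theorem robust_hot_counts : 4 * 5 * 5 ^ 3 = 2500 ∧ 6 * 12 ^ 2 * 5 ^ 2 = 21600 ∧ 2500 + 21600 = 24100 := by decide

/-- §2(c) `h²` of a robust hot pair is the product of the slot `|n|`'s: R1 ∈ `{1,3}`-products `⊆ [1, 81]`, R2 `≤ 3·3·4·4 = 144 = 16·9`;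
robust `Ext¹` pairs (`amp³·indef`): `4·12·5³ = 6000` ordered cell pairs, `h¹ ≤ 27·4`. -/
theorem h2_ranges : 3 ^ 4 = 81 ∧ 3 * 3 * 4 * 4 = 144 ∧ 16 * 9 = 144 ∧ 4 * 12 * 5 ^ 3 = 6000 ∧ 27 * 4 = 108 := by decide

/-! ## §3 Cells of `X = S⁴` and the two domination lemmas of the window alphabet -/

/-- a cell = one letter per factor -/
abbrev Cell := Fin 4 → Letter

/-- canonical incidence of cells (product order): `Hom(L_Z, L_W) ≠ 0` in the canonical lift iff `Z ≤ W` slotwise. -/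
def CellLE (Z W : Cell) : Prop := ∀ i, letterLE (Z i) (W i) = true

/-- the apex `⊤ = 15I⁴` -/
def top : Cell := fun _ => L15
/-- the hub cell `H_f = 14I` at slot `f`, `15I` elsewhere (`a = 1`, forced `ν = −2κ`, a P-cell) -/
def hub (f : Fin 4) : Cell := Function.update top f L14
/-- A-type cells: `14I` at one slot, rays elsewhere (pattern `4rrr`; all 256 are A-cells on `1d7e39cf`). -/
def AType (a : Cell) : Prop := ∃ f, a f = L14 ∧ ∀ g, g ≠ f → a g ∈ rays
/-- all-ray cells (pattern `rrrr`, slope 52) -/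
def AllRay (Z : Cell) : Prop := ∀ i, Z i ∈ rays
/-- cells of the window alphabet -/
def InAlphabet (Z : Cell) : Prop := ∀ i, Z i ∈ alphabet

/-- a ray below a letter: the letter itself if it is a ray, else `R₁` (every ray is below `14I` and `15I`). -/
def rayBelow (l : Letter) : Letter := if l ∈ rays then l else (13, 1, 0)

/-- the six one-factor facts used below. -/
theorem letter_facts :
    (∀ l ∈ alphabet, letterLE l L15 = true) ∧
    (∀ l ∈ alphabet, l ≠ L15 → letterLE l L14 = true) ∧
    (∀ l ∈ alphabet, letterLE (rayBelow l) l = true) ∧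
    (∀ l ∈ alphabet, rayBelow l ∈ rays) ∧
    (∀ l ∈ alphabet, letterLE L14 l = true → l = L14 ∨ l = L15) ∧
    (∀ l ∈ alphabet, (∀ r ∈ rays, letterLE l r = true → l = r)) := by
  refine ⟨by decide, by decide, by decide, by decide, by decide, by decide⟩

/-- §3(a) DOMINATION FROM ABOVE: every alphabet cell other than `⊤` lies below one of the four hub cells `H_f`. -/
theorem below_hub {Z : Cell} (hZ : InAlphabet Z) (hne : Z ≠ top) : ∃ f, CellLE Z (hub f) := by
  have : ∃ f, Z f ≠ L15 := by
    by_contra h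
    exact hne (funext fun i => Classical.byContradiction fun hi => h ⟨i, hi⟩)
  obtain ⟨f, hf⟩ := this
  refine ⟨f, fun i => ?_⟩
  by_cases hi : i = f
  · subst hi
    simp only [hub, Function.update_self]
    exact letter_facts.2.1 _ (hZ i) hf
  · simp only [hub, Function.update_of_ne hi, top]
    exact letter_facts.1 _ (hZ i)

/-- §3(b) DOMINATION FROM BELOW: every alphabet cell with a hub letter (`14I` or `15I`) in some slot lies above an A-type cell. -/
theorem above_AType {Z : Cell} (hZ : InAlphabet Z) (hhub : ∃ f, Z f = L14 ∨ Z f = L15) :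
    ∃ a, AType a ∧ CellLE a Z := by
  obtain ⟨f, hf⟩ := hhub
  refine ⟨fun g => if g = f then L14 else rayBelow (Z g), ⟨f, by simp, fun g hg => ?_⟩, fun i => ?_⟩
  · simp only [hg, if_false]
    exact letter_facts.2.2.2.1 _ (hZ g)
  · by_cases hi : i = f
    · subst hi
      simp only [if_true]
      rcases hf with h | h <;> rw [h] <;> decide
    · simp only [hi, if_false]
      exact letter_facts.2.2.1 _ (hZ i)

/-- converse bookkeeping: a cell above `⊤`… there is none but `⊤`; a cell below which no hub letter occurs is all-ray. -/
theorem allRay_of_no_hub {Z : Cell} (hZ : InAlphabet Z) (h : ∀ f, Z f ≠ L14 ∧ Z f ≠ L15) : AllRay Z := by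
  intro i
  have hi := hZ i
  simp only [alphabet, List.mem_append, List.mem_cons, List.not_mem_nil, or_false] at hi
  rcases hi with (h1 | h2) | h3
  · exact absurd h1 (h i).1
  · exact absurd h2 (h i).2
  · exact h3

/-! ## §4 THEOREM SF-W: the window orientations are canonically sandwich-free -/

/-- An orientation of a window design: multiplicities of A-, N-, C-cells (only positivity is used). -/
structure Orientation where
  mA : Cell → ℕ
  mN : Cell → ℕ
  mC : Cell → ℕ

namespace Orientation

variable (O : Orientation)

/-- canonically C-target-free: no C-cell receives a non-zero map from `L_Z` (then `q|_{N_Z} = 0`, `ψ_Z : N_Z → E` exists; g19 §3). -/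
def CTargetFree (Z : Cell) : Prop := ∀ c, 0 < O.mC c → ¬ CellLE Z c
/-- canonically A-source-free: no A-cell maps non-trivially to `L_{Z′}` (then `pr_{Z′} ∘ i = 0`, `φ_{Z′} : E → N_{Z′}` exists). -/
def ASourceFree (Z' : Cell) : Prop := ∀ a, 0 < O.mA a → ¬ CellLE a Z'
/-- admissible ordered pair (g19): distinct N-cells, `Z` C-target-free, `Z′` A-source-free. -/
def Admissible (Z Z' : Cell) : Prop := Z ≠ Z' ∧ 0 < O.mN Z ∧ 0 < O.mN Z' ∧ O.CTargetFree Z ∧ O.ASourceFree Z'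
/-- (O1): the four hub cells carry C-multiplicity (true on every window design of record: pattern `4555` ⊆ supp m_C). -/
def HubsInC : Prop := ∀ f, 0 < O.mC (hub f)
/-- (O2): every A-type cell carries A-multiplicity (true on `1d7e39cf`∕`2f9bdad8`: all 256 `4rrr` cells are A-cells;
on the sparse HNF∕B3 designs the engine checks domination directly). -/
def ATypesInA : Prop := ∀ a, AType a → 0 < O.mA a
/-- supports inside the window alphabet -/
def Supported : Prop := ∀ Z, 0 < O.mN Z → InAlphabet Z

/-- a C-target-free alphabet cell is the apex. -/
theorem cTargetFree_eq_top (h1 : O.HubsInC) {Z : Cell} (hZ : InAlphabet Z) (hfree : O.CTargetFree Z) : Z = top := by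
  by_contra hne
  obtain ⟨f, hf⟩ := below_hub hZ hne
  exact hfree (hub f) (h1 f) hf

/-- an A-source-free alphabet cell is all-ray. -/
theorem aSourceFree_allRay (h2 : O.ATypesInA) {Z : Cell} (hZ : InAlphabet Z) (hfree : O.ASourceFree Z) : AllRay Z := by
  apply allRay_of_no_hub hZ
  intro f
  by_contra hcon
  have hhub : ∃ f, Z f = L14 ∨ Z f = L15 := ⟨f, by tauto⟩
  obtain ⟨a, ha, hle⟩ := above_AType hZ hhub
  exact hfree a (h2 a ha) hle

/-- **THEOREM SF-W (letter level).** Under (O1), (O2) and alphabet support, every admissible ordered pair is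
`(⊤, all-ray cell)`, whose four slot differences `15I − R` are of type `amp` with `n = 3`: label-robustly (and canonically)
`Ext^k(L_{Z′}λ′, L_⊤λ) = 0` for all `k ≥ 1` — no sandwich source, no CUP-VANISHING obligation from admissible pairs. -/
theorem sandwichFree_window (h1 : O.HubsInC) (h2 : O.ATypesInA) (hS : O.Supported) {Z Z' : Cell}
    (hadm : O.Admissible Z Z') : Z = top ∧ AllRay Z' ∧ ∀ i, slotType (Z i) (Z' i) = amp ∧ nrm (diff (Z i) (Z' i)) = 3 := by
  obtain ⟨_, hN, hN', hC, hA⟩ := hadm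
  have hZ := O.cTargetFree_eq_top h1 (hS Z hN) hC
  have hZ' := O.aSourceFree_allRay h2 (hS Z' hN') hA
  refine ⟨hZ, hZ', fun i => ?_⟩
  subst hZ
  have hr := hZ' i
  have key := amp_pairs.2.2.1
  rw [List.all_eq_true] at key
  have := key (Z' i) hr
  simp only [Bool.and_eq_true, decide_eq_true_eq] at this
  exact this

/-- the robust type vector of an admissible window pair is `amp⁴`: robust degree `0` only (incidence, not heat). -/
theorem admissible_rdegSum (h1 : O.HubsInC) (h2 : O.ATypesInA) (hS : O.Supported) {Z Z' : Cell}
    (hadm : O.Admissible Z Z') : rdegSum (List.ofFn fun i => slotType (Z i) (Z' i)) = some 0 := by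
  have h := (O.sandwichFree_window h1 h2 hS hadm).2.2
  simp [List.ofFn_succ, h, rdegSum, rdeg]

end Orientation

/-- **LEMMA C (the pincer is cold).** The apex∕ray pair of `C4WindowPincer` (`⊤ ⊃ …`, `E ↠ I ⊂ L_R`): all four slots `amp`,
`n = 3` — so `Ext^k(L_Rλ′, L_⊤λ) = 0` for `k ≥ 1` and every cup `H^k(𝒪_X) ∪ φ_s`, `s ∈ H⁰(L_⊤λ ⊗ L_R^∨λ′^∨)` (the 81-dimensional
nilpotent algebra of THEOREM N) vanishes identically: g19's CUP-VANISHING obligation is discharged for the whole pincer algebra. -/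
theorem pincer_cold (R : Cell) (hR : AllRay R) : ∀ i, slotType (top i) (R i) = amp ∧ nrm (diff (top i) (R i)) = 3 := by
  intro i
  have key := amp_pairs.2.2.1
  rw [List.all_eq_true] at key
  have := key (R i) (hR i)
  simp only [Bool.and_eq_true, decide_eq_true_eq] at this
  exact this

/-! ## §5 Census digits of the six window designs of record (engine `code/g26/sandwich.py`, recorded not derived) -/

/-- one census row: design tag, table sha16, orientation source, N-cells, canonically C-target-free cells (`psi`),
A-source-free cells (`phi`), hot admissible pairs (canonical ∕ robust), `D_hot`, label-robust hot ordered pairs inside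
`supp N × supp N` regardless of admissibility (`exposure`: what a relabelling freeing both ends could open). -/
structure Census where
  tag : String
  sha16 : String
  orient : String
  nCells : ℕ
  psi : ℕ
  phi : ℕ
  hotCanonical : ℕ
  hotRobust : ℕ
  dHot : ℕ
  exposure : ℕ
  exposureR1 : ℕ
  exposureR2 : ℕ
  deriving DecidableEq

def cJointInt : Census := ⟨"JOINTLP-INT-ORIENTED", "1d7e39cf826568e5", "split", 776, 0, 256, 0, 0, 0, 15904, 1216, 14688⟩
def cHNF14 : Census := ⟨"HNF-g14-ORIENTED", "391e1c667e7bbccb", "split", 163, 1, 43, 0, 0, 0, 562, 112, 450⟩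
def cHNF13 : Census := ⟨"HNF-g13-ORIENTED", "891ad95a2dbd1669", "split", 163, 1, 43, 0, 0, 0, 562, 112, 450⟩
def cJointIntHint : Census := ⟨"JOINTLP-INT-hint", "2f9bdad87cc01e7b", "lp_split_hint", 776, 0, 256, 0, 0, 0, 15904, 1216, 14688⟩
def cB3Int : Census := ⟨"JOINTLP-B3-INT-hint", "6ff297a361bd2f0b", "lp_split_hint", 1036, 1, 16, 0, 0, 0, 22832, 1232, 21600⟩
def cHNF14virt : Census := ⟨"HNF-g14-virtual", "35ef4197b5f3fa6a", "P-free bound", 163, 1, 43, 0, 0, 0, 562, 112, 450⟩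

/-- the six designs of record -/
def ofRecord : List Census := [cJointInt, cHNF14, cHNF13, cJointIntHint, cB3Int, cHNF14virt]

/-- consistency of the recorded digits: every window design is canonically AND robustly SANDWICH-FREE (`hot = 0`, `D_hot = 0`),
`psi ≤ 1` (only `⊤` can be C-target-free; it is not when `⊤ ∈ supp m_C`, `m_C(⊤) = 122` on `1d7e39cf`∕`2f9bdad8`),
and the exposure splits as R1 + R2.  Contrast: `C4BFSandwich.Design.ofRecord_checks` (program M: `hot ∈ {216, 240}`). -/
theorem ofRecord_checks :
    ofRecord.length = 6 ∧
    ∀ c ∈ ofRecord, c.hotCanonical = 0 ∧ c.hotRobust = 0 ∧ c.dHot = 0 ∧ c.psi ≤ 1 ∧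
      c.exposure = c.exposureR1 + c.exposureR2 ∧ 0 < c.exposure := by
  decide

/-- admissible-pair counts `psi · phi ∈ {0, 43, 16}` — all of them `(⊤, free ray cell)`, all cold (§4). -/
theorem admissible_counts : 0 * 256 = 0 ∧ 1 * 43 = 43 ∧ 1 * 16 = 16 ∧ (81 : ℕ) = 3 ^ 4 := by decide

/-! ## §6 (v1.1, g27) The hub cube `{14I<15I}⁴`: HUB-HALL LAW, forced (O1∨⊤), THEOREM SF-W♯

Pen facts used (memo §1): the Chern-character bookkeeping of a display `[E] = [N] − [A] − [C]` read cell by cell,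
`m_N(Z) = ν(Z) + m_A(Z) + m_C(Z)` with `ν` the forced virtual multiplicity (g25 THEOREM H, monad-4 LAW); on the hub cube
`ν(14I^a·15I^{4−a}) = κ(−2)^a` (`κ = 1792` on the designs of record; `+ r = rank` at the bottom vertex `14I⁴`); and
`Hom(L_Zλ, L_Wλ′) ≠ 0 ⇒ Z ≤ W` slotwise (`letterLE`) for EVERY pair of labels (§1(c)).  Injectivity of the display map `i : A → N`
then gives, for every up-set `U` of the hub cube, an injective sheaf map `A_U → N_U` (§6(b): the targets of a hub A-cell are hub cells
above it), hence HALL `m_A(U) ≤ m_N(U)`; everything below is its arithmetic. -/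

/-- §6(a) one-factor closure facts: above `15I` only `15I`; above `14I` only `14I, 15I`; and `15I − l` is of type `zero` (`l = 15I`) or
`amp` (`l = 14I` or a ray) for every alphabet letter `l`. -/
theorem hub_letter_facts :
    (∀ l ∈ alphabet, letterLE L15 l = true → l = L15) ∧
    (∀ l ∈ alphabet, letterLE L14 l = true → l = L14 ∨ l = L15) ∧
    (∀ l ∈ alphabet, (slotType L15 l = zero ∧ l = L15) ∨ (slotType L15 l = amp ∧ l ≠ L15)) := by
  refine ⟨by decide, by decide, by decide⟩

/-- a vertex of the hub cube: per slot `true ↦ 15I`, `false ↦ 14I`. -/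
abbrev HubV := Fin 4 → Bool

/-- the hub cell of a vertex. -/
def hubCell (v : HubV) : Cell := fun f => if v f = true then L15 else L14
/-- the top vertex (`⊤ = 15I⁴`). -/
def topV : HubV := fun _ => true
/-- the bottom vertex (`14I⁴`, the unique cell with `a = 4`; `ν = 16κ + r`). -/
def botV : HubV := fun _ => false
/-- the hub vertices (`H_f`, `a = 1`). -/
def hubV (f : Fin 4) : HubV := Function.update topV f false
/-- the `a = 3` vertices (`15I` at slot `k` only). -/
def a3V (k : Fin 4) : HubV := Function.update botV k true

/-- `bitA b = [b = 14I]`. -/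
def bitA (b : Bool) : ℕ := if b = true then 0 else 1
/-- `a(v)` = the number of `14I` slots. -/
def aCount (v : HubV) : ℕ := bitA (v 0) + bitA (v 1) + bitA (v 2) + bitA (v 3)

/-- the forced virtual multiplicity as a function of `a`, in terms of the unit `κ` and the rank `r`:
`κ, −2κ, 4κ, −8κ, 16κ + r` (`= κ(−2)^a + r[a = 4]`). -/
def nuOfA (κ r : ℤ) : ℕ → ℤ
  | 0 => κ
  | 1 => -2 * κ
  | 2 => 4 * κ
  | 3 => -8 * κ
  | 4 => 16 * κ + r
  | _ => 0

/-- `ν` on the hub cube. -/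
def nuHub (κ r : ℤ) (v : HubV) : ℤ := nuOfA κ r (aCount v)

theorem nuOfA_closed (κ r : ℤ) :
    nuOfA κ r 0 = κ * (-2) ^ 0 ∧ nuOfA κ r 1 = κ * (-2) ^ 1 ∧ nuOfA κ r 2 = κ * (-2) ^ 2 ∧
    nuOfA κ r 3 = κ * (-2) ^ 3 ∧ nuOfA κ r 4 = κ * (-2) ^ 4 + r := by
  refine ⟨?_, ?_, ?_, ?_, ?_⟩ <;> simp only [nuOfA] <;> ring

theorem hubCell_topV : hubCell topV = top := by
  funext f; simp [hubCell, topV, top]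

theorem hubCell_hubV (f : Fin 4) : hubCell (hubV f) = hub f := by
  funext g
  by_cases h : g = f
  · subst h; simp [hubCell, hubV, hub]
  · simp [hubCell, hubV, hub, h, topV, top]

theorem aCount_named (f : Fin 4) : aCount topV = 0 ∧ aCount botV = 4 ∧ aCount (hubV f) = 1 ∧ aCount (a3V f) = 3 := by
  refine ⟨by decide, by decide, ?_, ?_⟩ <;> fin_cases f <;> decide

/-- `ν(⊤) = κ`, `ν(H_f) = −2κ`, `ν(14I³15I_k) = −8κ`, `ν(14I⁴) = 16κ + r`. -/
theorem nuHub_named (κ r : ℤ) (f : Fin 4) :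
    nuHub κ r topV = κ ∧ nuHub κ r (hubV f) = -2 * κ ∧ nuHub κ r (a3V f) = -8 * κ ∧ nuHub κ r botV = 16 * κ + r := by
  obtain ⟨h0, h4, h1, h3⟩ := aCount_named f
  refine ⟨?_, ?_, ?_, ?_⟩ <;> simp only [nuHub, h0, h1, h3, h4] <;> rfl

theorem topV_ne_hubV (f : Fin 4) : topV ≠ hubV f := by
  intro h
  have := congr_fun h f
  simp [topV, hubV] at this

/-- §6(b) CLOSURE: an alphabet cell above a hub cell is a hub cell above it.  Hence, for an up-set `U` of the hub cube, the A-copies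
over `U` map into the N-copies over `U` (any labelling), and injectivity of `i` gives HALL `m_A(U) ≤ m_N(U)`. -/
theorem above_hubCell {v : HubV} {W : Cell} (hW : InAlphabet W) (hle : CellLE (hubCell v) W) :
    ∃ w : HubV, W = hubCell w ∧ ∀ f, v f = true → w f = true := by
  refine ⟨fun f => decide (W f = L15), funext fun f => ?_, fun f hf => ?_⟩
  · show W f = if decide (W f = L15) = true then L15 else L14
    have h := hle f
    cases hv : v f
    · have h' : letterLE L14 (W f) = true := by simpa [hubCell, hv] using h
      rcases hub_letter_facts.2.1 _ (hW f) h' with h1 | h1 <;> rw [h1] <;> decide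
    · have h' : letterLE L15 (W f) = true := by simpa [hubCell, hv] using h
      have h1 := hub_letter_facts.1 _ (hW f) h'
      rw [h1]; decide
  · have h := hle f
    have h' : letterLE L15 (W f) = true := by simpa [hubCell, hf] using h
    have h1 := hub_letter_facts.1 _ (hW f) h'
    show decide (W f = L15) = true
    rw [h1]; decide

namespace Orientation

variable (O : Orientation)

/-- the bookkeeping `m_N = ν + m_A + m_C` on the hub cells, for a virtual multiplicity `ν`. -/
def HubBalanced (nu : HubV → ℤ) : Prop :=
  ∀ v, (O.mN (hubCell v) : ℤ) = nu v + O.mA (hubCell v) + O.mC (hubCell v)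

/-- HALL on a set `U` of hub vertices: no more A-copies than N-copies over `U` (for an up-set: generic injectivity of `i`, §6(b)). -/
def HubHall (U : Finset HubV) : Prop :=
  ∑ v ∈ U, O.mA (hubCell v) ≤ ∑ v ∈ U, O.mN (hubCell v)

/-- **HUB-HALL LAW.** On every Hall set, `m_C(U) ≥ −ν(U)`. -/
theorem mC_upset_ge {nu : HubV → ℤ} (hB : O.HubBalanced nu) {U : Finset HubV} (hH : O.HubHall U) :
    -(∑ v ∈ U, nu v) ≤ ∑ v ∈ U, (O.mC (hubCell v) : ℤ) := by
  have h : ((∑ v ∈ U, O.mA (hubCell v) : ℕ) : ℤ) ≤ ((∑ v ∈ U, O.mN (hubCell v) : ℕ) : ℤ) := by exact_mod_cast hH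
  push_cast at h
  rw [Finset.sum_congr rfl fun v _ => hB v, Finset.sum_add_distrib, Finset.sum_add_distrib] at h
  linarith

/-- canonical A-ISOLATION at a hub vertex (monad-4 g25, read on the hub: in the canonical lift every up-step out of a hub cell is a
theta step `15I − 14I`, `h⁰ = 1`, so on the deepest theta stratum the A-copies of the cell map only to its own N-copies). -/
def HubIsolated (v : HubV) : Prop := O.mA (hubCell v) ≤ O.mN (hubCell v)

/-- single-cell form: `m_C(Z) ≥ −ν(Z)` at an isolated vertex (content at odd `a`: `2κ` at `H_f`, `8κ` at `14I³15I`). -/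
theorem mC_cell_ge {nu : HubV → ℤ} (hB : O.HubBalanced nu) {v : HubV} (hI : O.HubIsolated v) :
    -nu v ≤ (O.mC (hubCell v) : ℤ) := by
  have h := hB v
  have : (O.mA (hubCell v) : ℤ) ≤ O.mN (hubCell v) := by exact_mod_cast hI
  linarith

/-- the up-set `{⊤, H_f}` as a Finset of vertices. -/
def pairSet (f : Fin 4) : Finset HubV := {topV, hubV f}

theorem hubHall_pairSet_iff (f : Fin 4) :
    O.HubHall (pairSet f) ↔ O.mA top + O.mA (hub f) ≤ O.mN top + O.mN (hub f) := by
  simp [HubHall, pairSet, Finset.sum_pair (topV_ne_hubV f), hubCell_topV, hubCell_hubV]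

theorem nu_pairSet (κ r : ℤ) (f : Fin 4) : ∑ v ∈ pairSet f, nuHub κ r v = -κ := by
  rw [pairSet, Finset.sum_pair (topV_ne_hubV f), (nuHub_named κ r f).1, (nuHub_named κ r f).2.1]
  ring

/-- the bookkeeping at the apex (`ν(⊤) = κ`) and at the four hubs (`ν(H_f) = −2κ`), stated without the cube. -/
def ApexBalanced (κ : ℤ) : Prop :=
  ((O.mN top : ℤ) = κ + O.mA top + O.mC top) ∧ ∀ f, (O.mN (hub f) : ℤ) = -2 * κ + O.mA (hub f) + O.mC (hub f)
/-- HALL for the up-set `{⊤, H_f}`. -/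
def HallPair (f : Fin 4) : Prop := O.mA top + O.mA (hub f) ≤ O.mN top + O.mN (hub f)
/-- HALL for the up-set `{⊤, H_0, H_1, H_2, H_3}`. -/
def HallJoint : Prop :=
  O.mA top + (O.mA (hub 0) + O.mA (hub 1) + O.mA (hub 2) + O.mA (hub 3)) ≤
    O.mN top + (O.mN (hub 0) + O.mN (hub 1) + O.mN (hub 2) + O.mN (hub 3))

theorem hubBalanced_apex {κ r : ℤ} (hB : O.HubBalanced (nuHub κ r)) : O.ApexBalanced κ := by
  refine ⟨?_, fun f => ?_⟩
  · have h := hB topV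
    rw [hubCell_topV, (nuHub_named κ r 0).1] at h
    exact h
  · have h := hB (hubV f)
    rw [hubCell_hubV, (nuHub_named κ r f).2.1] at h
    exact h

/-- **APEX PAIR**: `m_C(⊤) + m_C(H_f) ≥ κ` (census slack `1436 ∕ 1792 ∕ 12572 ∕ 2871⁄2 ∕ 1792`). -/
theorem apex_pair {κ : ℤ} (hB : O.ApexBalanced κ) {f : Fin 4} (hH : O.HallPair f) :
    κ ≤ (O.mC top : ℤ) + O.mC (hub f) := by
  obtain ⟨h0, h1⟩ := hB
  have h1f := h1 f
  have : (O.mA top : ℤ) + O.mA (hub f) ≤ O.mN top + O.mN (hub f) := by exact_mod_cast hH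
  linarith

/-- the same inequality as an instance of the HUB-HALL LAW on the Finset `{⊤, H_f}`. -/
theorem apex_pair' {κ r : ℤ} (hB : O.HubBalanced (nuHub κ r)) {f : Fin 4} (hH : O.HubHall (pairSet f)) :
    κ ≤ (O.mC top : ℤ) + O.mC (hub f) := by
  have h := O.mC_upset_ge hB hH
  rw [nu_pairSet, pairSet, Finset.sum_pair (topV_ne_hubV f), hubCell_topV, hubCell_hubV] at h
  linarith

/-- **APEX JOINT**: `m_C(⊤) + Σ_f m_C(H_f) ≥ 7κ = 12544` (census slack `2 ∕ 1792 ∕ 12572 ∕ 0 (TIGHT on 2f9bdad8) ∕ 1792`). -/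
theorem apex_joint {κ : ℤ} (hB : O.ApexBalanced κ) (hH : O.HallJoint) :
    7 * κ ≤ (O.mC top : ℤ) + (O.mC (hub 0) + O.mC (hub 1) + O.mC (hub 2) + O.mC (hub 3)) := by
  obtain ⟨h0, h1⟩ := hB
  have e0 := h1 0; have e1 := h1 1; have e2 := h1 2; have e3 := h1 3
  have : (O.mA top : ℤ) + (O.mA (hub 0) + O.mA (hub 1) + O.mA (hub 2) + O.mA (hub 3)) ≤
      O.mN top + (O.mN (hub 0) + O.mN (hub 1) + O.mN (hub 2) + O.mN (hub 3)) := by exact_mod_cast hH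
  linarith

/-- (O1∨⊤) in positivity form. -/
def ApexPos : Prop := ∀ f, 0 < O.mC top + O.mC (hub f)

theorem apexPos_of_hall {κ : ℤ} (hκ : 0 < κ) (hB : O.ApexBalanced κ) (hH : ∀ f, O.HallPair f) : O.ApexPos := by
  intro f
  have h := O.apex_pair hB (hH f)
  omega

/-- **(O1∨⊤) IS FORCED**: either `⊤` is a C-cell or all four hubs are (hypothesis (O1) of §4) — S3′ of g26 answered. -/
theorem forced_O1 (hP : O.ApexPos) : 0 < O.mC top ∨ O.HubsInC := by
  by_cases h : 0 < O.mC top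
  · exact Or.inl h
  · exact Or.inr fun f => by have := hP f; omega

/-- `ψ ⊆ {⊤}` orientation-free: a canonically C-target-free alphabet cell is `⊤`, and then `m_C(⊤) = 0`. -/
theorem cTargetFree_sharp (hP : O.ApexPos) {Z : Cell} (hZ : InAlphabet Z) (hfree : O.CTargetFree Z) :
    Z = top ∧ O.mC top = 0 := by
  have hle : CellLE Z top := fun i => letter_facts.1 _ (hZ i)
  have h0 : O.mC top = 0 := by
    by_contra h
    exact hfree top (Nat.pos_of_ne_zero h) hle
  refine ⟨?_, h0⟩
  rcases O.forced_O1 hP with h | h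
  · omega
  · exact O.cTargetFree_eq_top h hZ hfree

/-- (O2‴): every N-cell with a `15I` slot lies above a cell with A-multiplicity (census: 0 exceptions among the
`423 ∕ 95 ∕ 95 ∕ 423 ∕ 427` such N-cells of the five oriented designs; weaker than (O2) of §4). -/
def Has15Dominated : Prop := ∀ Z, 0 < O.mN Z → (∃ f, Z f = L15) → ∃ a, 0 < O.mA a ∧ CellLE a Z

/-- **THEOREM SF-W♯ (orientation-free).** Under alphabet support and the apex-pair Hall inequalities alone, an admissible pair is
`(⊤, Z′)` with `m_C(⊤) = 0`, and each slot is of type `zero` (where `Z′` has `15I`) or `amp` (elsewhere). -/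
theorem sandwichFree_sharp (hP : O.ApexPos) (hS : O.Supported) {Z Z' : Cell} (hadm : O.Admissible Z Z') :
    Z = top ∧ O.mC top = 0 ∧
      ∀ i, (slotType (Z i) (Z' i) = zero ∧ Z' i = L15) ∨ (slotType (Z i) (Z' i) = amp ∧ Z' i ≠ L15) := by
  obtain ⟨_, hN, hN', hC, _⟩ := hadm
  obtain ⟨hZ, h0⟩ := O.cTargetFree_sharp hP (hS Z hN) hC
  refine ⟨hZ, h0, fun i => ?_⟩
  subst hZ
  exact hub_letter_facts.2.2 _ (hS Z' hN' i)

/-- with (O2‴) the `zero` slots are excluded: all four slots `amp` (as in THEOREM SF-W, without assuming (O1) or (O2)). -/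
theorem sandwichFree_sharp_O2 (hP : O.ApexPos) (hS : O.Supported) (hD : O.Has15Dominated) {Z Z' : Cell}
    (hadm : O.Admissible Z Z') : Z = top ∧ ∀ i, slotType (Z i) (Z' i) = amp ∧ Z' i ≠ L15 := by
  obtain ⟨hZ, _, hslots⟩ := O.sandwichFree_sharp hP hS hadm
  obtain ⟨_, _, hN', _, hA⟩ := hadm
  have hno : ∀ i, Z' i ≠ L15 := by
    intro i hi
    obtain ⟨a, ha, hle⟩ := hD Z' hN' ⟨i, hi⟩
    exact hA a ha hle
  exact ⟨hZ, fun i => (hslots i).resolve_left fun h => hno i h.2⟩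

end Orientation

/-- §6(e) a `{zero, amp}` type vector is never label-robustly hot: no `anti`, no `indef` slot, so neither R1 nor R2, and its robust
degree is `0` (all `amp`) or undefined (a fragile `zero` slot).  Canonically a `zero` slot contributes `(1,2,1)`, so `(⊤, Z′)` is
canonically hot iff `Z′` has a `15I` slot (`h² = C(2z,2)·3^{#rays}`, `z = #15I`-slots) — excluded by (O2‴). -/
theorem zeroAmp_cold (a b c d : SlotType) (ha : a = zero ∨ a = amp) (hb : b = zero ∨ b = amp)
    (hc : c = zero ∨ c = amp) (hd : d = zero ∨ d = amp) :
    isR1 [a, b, c, d] = false ∧ isR2 [a, b, c, d] = false ∧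
      (rdegSum [a, b, c, d] = some 0 ∨ rdegSum [a, b, c, d] = none) := by
  rcases ha with rfl | rfl <;> rcases hb with rfl | rfl <;> rcases hc with rfl | rfl <;> rcases hd with rfl | rfl <;> decide

/-- the cell-level corollary of SF-W♯: the type vector of an admissible pair is neither R1 nor R2 (label-robustly COLD in degree 2). -/
theorem Orientation.sandwichFree_sharp_cold (O : Orientation) (hP : O.ApexPos) (hS : O.Supported) {Z Z' : Cell}
    (hadm : O.Admissible Z Z') :
    isR1 (List.ofFn fun i => slotType (Z i) (Z' i)) = false ∧ isR2 (List.ofFn fun i => slotType (Z i) (Z' i)) = false ∧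
      (rdegSum (List.ofFn fun i => slotType (Z i) (Z' i)) = some 0 ∨
        rdegSum (List.ofFn fun i => slotType (Z i) (Z' i)) = none) := by
  have h := (O.sandwichFree_sharp hP hS hadm).2.2
  have h' : ∀ i, slotType (Z i) (Z' i) = zero ∨ slotType (Z i) (Z' i) = amp := fun i =>
    (h i).elim (fun p => Or.inl p.1) fun p => Or.inr p.1
  simp only [List.ofFn_succ, List.ofFn_zero]
  exact zeroAmp_cold _ _ _ _ (h' _) (h' _) (h' _) (h' _)

/-- canonical heat count of `(⊤, Z′)` with `z` slots `15I` and `4 − z` ray∕`14I` slots: `h² = C(2z, 2)·∏ n` — e.g. `Z′ = H_f`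
(`z = 3`, one `14I`): `C(6,2) = 15`; `Z′` with one `15I` and three rays: `C(2,2)·27 = 27`; `z = 0`: `0` (LEMMA C). -/
theorem canonical_heat_counts : Nat.choose 6 2 = 15 ∧ Nat.choose 2 2 * 3 ^ 3 = 27 ∧ Nat.choose 0 2 = 0 ∧ Nat.choose 8 2 = 28 := by
  decide

/-! ### §6(f) The up-set table of the hub cube and the census (engine `code/g27/apexhall.py`, recorded not derived)

The hub cube `B₄` has `168` up-sets (the Dedekind number `M(4)`); `52` are BINDING (`−ν(U) > 0`); by `S₄`-orbit type
(need in units of `κ`, size, `a`-profile of the generators, orbit length):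
`(15, 15, 3333, 1)  (7, 14, 333, 4)  (7, 5, 1111, 1)  (5, 4, 111, 4)  (3, 12, 33, 6)  (3, 9, 13, 4)  (3, 6, 112, 6)  (3, 3, 11, 6)
 (1, 8, 3, 4)  (1, 5, 12, 12)  (1, 2, 1, 4)` — needs histogram `{1:20, 3:22, 5:4, 7:5, 15:1}`; the bottom vertex `14I⁴` (the only place
the rank `r` enters `ν`) lies in no binding up-set.  The strongest law is `m_C(a ≤ 3) ≥ 15κ = 26880`. -/

/-- the `ν∕κ`-sums of the eleven binding orbit types and the orbit count `52`. -/
theorem upset_table :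
    (1:ℤ) - 4 * 2 + 6 * 4 - 4 * 8 = -15 ∧ (1:ℤ) - 4 * 2 + 6 * 4 - 3 * 8 = -7 ∧ (1:ℤ) - 4 * 2 = -7 ∧ (1:ℤ) - 3 * 2 = -5 ∧
    (1:ℤ) - 4 * 2 + 5 * 4 - 2 * 8 = -3 ∧ (1:ℤ) - 4 * 2 + 3 * 4 - 8 = -3 ∧ (1:ℤ) - 4 * 2 + 4 = -3 ∧ (1:ℤ) - 2 * 2 = -3 ∧
    (1:ℤ) - 3 * 2 + 3 * 4 - 8 = -1 ∧ (1:ℤ) - 3 * 2 + 4 = -1 ∧ (1:ℤ) - 2 = -1 ∧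
    1 + 4 + 1 + 4 + 6 + 4 + 6 + 6 + 4 + 12 + 4 = 52 ∧ 20 + 22 + 4 + 5 + 1 = 52 ∧
    15 * 1792 = 26880 ∧ 7 * 1792 = 12544 ∧ 2 * 1792 = 3584 ∧ 8 * 1792 = 14336 ∧ 16 * 1792 + 4 = 28676 := by
  decide

/-- one §6 census row of an ORIENTED window design (multiplicities doubled where the LP-hint orientation `2f9bdad8` is half-integral):
`kappa`; `mCtop = m_C(⊤)`; `twoMChub = 2·m_C(H_f)` and `twoMAhub = 2·m_A(H_f)` (equal for the four `f`); `mNhub = m_N(H_f)`;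
`mCa3 = m_C(14I³15I_k)`, `mAa3`, `mNa3` (equal for the four `k`); `bindingOK` = binding up-sets satisfied generically (of 52);
`thetaViol` = up-sets violating the canonical (A-isolated) layer over all sub-cubes; `n15` = N-cells with a `15I` slot and `n15bad` =
those NOT above an A-cell ((O2‴) exceptions); `psi` = canonically C-target-free N-cells. -/
structure Census2 where
  tag : String
  sha16 : String
  kappa : ℕ
  mCtop : ℕ
  twoMChub : ℕ
  twoMAhub : ℕ
  mNhub : ℕ
  mCa3 : ℕ
  mAa3 : ℕ
  mNa3 : ℕ
  bindingOK : ℕ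
  thetaViol : ℕ
  n15 : ℕ
  n15bad : ℕ
  psi : ℕ
  deriving DecidableEq

def dJointInt : Census2 := ⟨"JOINTLP-INT-ORIENTED", "1d7e39cf826568e5", 1792, 122, 6212, 956, 0, 3584, 10752, 0, 52, 86, 423, 0, 0⟩
def dHNF14 : Census2 := ⟨"HNF-g14-ORIENTED", "391e1c667e7bbccb", 1792, 0, 7168, 0, 0, 14336, 0, 0, 52, 0, 95, 0, 1⟩
def dHNF13 : Census2 := ⟨"HNF-g13-ORIENTED", "891ad95a2dbd1669", 12572, 0, 50288, 0, 0, 100576, 0, 0, 52, 0, 95, 0, 1⟩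
def dJointIntHint : Census2 := ⟨"JOINTLP-INT-hint", "2f9bdad87cc01e7b", 1792, 122, 6211, 957, 0, 3584, 10752, 0, 52, 86, 423, 0, 0⟩
def dB3Int : Census2 := ⟨"JOINTLP-B3-INT-hint", "6ff297a361bd2f0b", 1792, 0, 7168, 0, 0, 15022, 0, 686, 52, 0, 427, 0, 1⟩

/-- the five oriented designs of record (the sixth table `35ef4197` carries no orientation: only the (O2‴) P-free bound `0 ∕ 95`). -/
def ofRecord2 : List Census2 := [dJointInt, dHNF14, dHNF13, dJointIntHint, dB3Int]

/-- consistency of the recorded digits with §6(b)–(e): on all five, the 52 binding up-sets hold generically; the APEX PAIR and APEX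
JOINT inequalities hold (doubled: `2κ ≤ 2m_C(⊤) + 2m_C(H)`, `14κ ≤ 2m_C(⊤) + 4·2m_C(H)`), the joint one TIGHT exactly on `2f9bdad8`;
(O1) holds outright (`m_C(H_f) > 0`) and `psi = [m_C(⊤) = 0] ≤ 1` (ψ ⊆ {⊤}); (O2‴) has no exception; and the canonical layer is
violation-free exactly where the hub and `a = 3` cells are A-isolated (`2m_A(H) ≤ 2m_N(H)`, `m_A(a3) ≤ m_N(a3)`), in which case
`m_C(H_f) ≥ 2κ` and `m_C(14I³15I) ≥ 8κ` hold — with equality on the HNF pair. -/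
theorem ofRecord2_checks :
    ofRecord2.length = 5 ∧
    ∀ c ∈ ofRecord2,
      c.bindingOK = 52 ∧ c.n15bad = 0 ∧ 0 < c.twoMChub ∧ c.psi = (if c.mCtop = 0 then 1 else 0) ∧ c.psi ≤ 1 ∧
      2 * c.kappa ≤ 2 * c.mCtop + c.twoMChub ∧ 14 * c.kappa ≤ 2 * c.mCtop + 4 * c.twoMChub ∧
      (14 * c.kappa = 2 * c.mCtop + 4 * c.twoMChub ↔ c.sha16 = "2f9bdad87cc01e7b") ∧
      (c.thetaViol = 0 ↔ (c.twoMAhub ≤ 2 * c.mNhub ∧ c.mAa3 ≤ c.mNa3)) ∧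
      (c.thetaViol = 0 → 4 * c.kappa ≤ c.twoMChub ∧ 8 * c.kappa ≤ c.mCa3) ∧
      ((4 * c.kappa = c.twoMChub ∧ 8 * c.kappa = c.mCa3) ↔ (c.sha16 = "391e1c667e7bbccb" ∨ c.sha16 = "891ad95a2dbd1669")) := by
  decide

/-- the two generic slacks quoted in the memo: joint apex slack `2` on `1d7e39cf` (`122 + 4·3106 − 12544`), `0` on `2f9bdad8`
(`2·122 + 4·6211 = 2·12544`), and the canonical shortfalls there (`3106 < 3584`, `3584 < 14336`). -/
theorem census_slacks :
    122 + 4 * 3106 - 12544 = 2 ∧ 2 * 122 + 4 * 6211 = 2 * 12544 ∧ 3106 < 3584 ∧ 3584 < 14336 ∧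
    0 + 4 * 3584 - 12544 = 1792 ∧ 4 * 25144 - 7 * 12572 = 12572 := by
  decide

end HSemireg.C4SandwichWindow
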